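import Summits.RiemannHypothesis.RiemannHypothesis.Theorems.TiltedLandingLaw421Seam10

/-! # TiltedLandingLaw421FieldSplitNodeA
c12 FieldSplit node, part A: `SuccOf`, `IsolatedPairDrop(G)`, `DenseLevelCensus(G/Stop)`, glue to `DescentSigS'`, `IsLowest`, `HasLowestSig`, `DenseLevelCensusLow/StopLow`, the dials `PSealC1…C6`, lemma catalogue `Lemma…`.
SUPPORT module for crux `TiltedLandingLaw421` (stmt-RiemannHypothesis-24774), `--supports` only: proves no stub, no crux; fully proved (no `sorry`).
Packaged by C4 rh-idea-6 g21 per director (CA239)(1) in the (CA237) lint shape. RH is not proved. -/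

namespace RhW07.C12.FieldSplit

open Set Complex
open RhIdea6.G17.W07C7 RhIdea6.G17.W07C7.Annex RhIdea6.G17.W07C7.Rev6 RhIdea6.G18.W07C8.Law421BirthS RhIdea6.G19.W07C11.Seam
open RhIdea6.G20.W07C12.Frac RhIdea6.G20.W07C12.StColP

/-- `SuccOf` (W-07 c12 FieldSplit node for crux TiltedLandingLaw421; token-identical to the registered line fieldsplit_v1 d6eb6582). -/
def SuccOf (μ : ℝ) (St : StatePred) : StatePred := fun η f x₀ s hmax R Hs B j u =>
 ∃ u' : ℂ, St η f x₀ s hmax R Hs B (j + 1) u' ∧ |u'.im| + μ * s ≤ |u.im|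

/-- `succS_eq_succOf` (W-07 c12 FieldSplit node for crux TiltedLandingLaw421; token-identical to the registered line fieldsplit_v1 d6eb6582). -/
theorem succS_eq_succOf (μ : ℝ) : SuccS μ = SuccOf μ StCol := rfl
/-- `succS'_eq_succOf` (W-07 c12 FieldSplit node for crux TiltedLandingLaw421; token-identical to the registered line fieldsplit_v1 d6eb6582). -/
theorem succS'_eq_succOf (μ : ℝ) : SuccS' μ = SuccOf μ StCol' := rfl

/-- `succOf_of_lower` (W-07 c12 FieldSplit node for crux TiltedLandingLaw421; token-identical to the registered line fieldsplit_v1 d6eb6582). -/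
theorem succOf_of_lower {μ : ℝ} {St : StatePred} {η : ℝ} {f : ℂ → ℂ} {x₀ s hmax R Hs : ℝ} {B j : ℕ} {u v : ℂ}
   (hv : SuccOf μ St η f x₀ s hmax R Hs B j v) (hle : |v.im| ≤ |u.im|) : SuccOf μ St η f x₀ s hmax R Hs B j u := by
 obtain ⟨u', hS', hdrop⟩ := hv
 exact ⟨u', hS', le_trans hdrop hle⟩

/-- `IsolatedPairDropG` (W-07 c12 FieldSplit node for crux TiltedLandingLaw421; token-identical to the registered line fieldsplit_v1 d6eb6582). -/
def IsolatedPairDropG (μ : ℝ) (P St Ready : StatePred) : Prop :=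
 ∀ (η : ℝ) (f : ℂ → ℂ) (x₀ s hmax R Hs : ℝ) (B : ℕ), EngineHyps5 2 η f x₀ s hmax R Hs B →
   ∀ (j : ℕ) (u : ℂ), St η f x₀ s hmax R Hs B j u → ¬ Ready η f x₀ s hmax R Hs B j u →
     P η f x₀ s hmax R Hs B j u → SuccOf μ St η f x₀ s hmax R Hs B j u

/-- `DenseLevelCensusG` (W-07 c12 FieldSplit node for crux TiltedLandingLaw421; token-identical to the registered line fieldsplit_v1 d6eb6582). -/
def DenseLevelCensusG (μ cE : ℝ) (P St Ready : StatePred) : Prop :=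
 ∀ (η : ℝ) (f : ℂ → ℂ) (x₀ s hmax R Hs : ℝ) (B : ℕ), EngineHyps5 2 η f x₀ s hmax R Hs B →
   ∃ (E : Finset ℕ) (lam : ℕ → ℝ), (∀ j : ℕ, 0 ≤ lam j) ∧
     (E.card : ℝ) + (∑ e ∈ E, lam e) / (μ * s) ≤ (Hs / s) ^ 2 + B + cE ∧
     (∀ (j : ℕ) (u : ℂ), j ∉ E → St η f x₀ s hmax R Hs B j u → ¬ Ready η f x₀ s hmax R Hs B j u →
       ∃ v : ℂ, St η f x₀ s hmax R Hs B j v ∧ ¬ Ready η f x₀ s hmax R Hs B j v ∧ |v.im| ≤ |u.im| ∧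
         P η f x₀ s hmax R Hs B j v) ∧
     (∀ (j : ℕ) (u : ℂ), j ∈ E → St η f x₀ s hmax R Hs B j u → ¬ Ready η f x₀ s hmax R Hs B j u →
       ∃ u' : ℂ, St η f x₀ s hmax R Hs B (j + 1) u' ∧ |u'.im| ≤ |u.im| + lam j)

/-- `liftV'_of_fieldSplitG` (W-07 c12 FieldSplit node for crux TiltedLandingLaw421; token-identical to the registered line fieldsplit_v1 d6eb6582). -/
theorem liftV'_of_fieldSplitG {μ cE : ℝ} {P St Ready : StatePred}
   (hα : IsolatedPairDropG μ P St Ready) (hβ : DenseLevelCensusG μ cE P St Ready) :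
   SurplusLiftSigV' μ cE St Ready (SuccOf μ St) := by
 intro η f x₀ s hmax R Hs B hE
 obtain ⟨E, lam, hlam0, hsum, hoff, hon⟩ := hβ η f x₀ s hmax R Hs B hE
 refine ⟨E, lam, hlam0, hsum, ?_, hon⟩
 intro j u hj hS
 by_cases hR : Ready η f x₀ s hmax R Hs B j u
 · exact Or.inl hR
 · obtain ⟨v, hSv, hRv, hle, hPv⟩ := hoff j u hj hS hR
   exact Or.inr (succOf_of_lower (hα η f x₀ s hmax R Hs B hE j v hSv hRv hPv) hle)

/-- `isolatedPairDropG_anti` (W-07 c12 FieldSplit node for crux TiltedLandingLaw421; token-identical to the registered line fieldsplit_v1 d6eb6582). -/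
theorem isolatedPairDropG_anti {μ : ℝ} {P P' St Ready : StatePred}
   (hPP : ∀ η f x₀ s hmax R Hs B j u, P' η f x₀ s hmax R Hs B j u → P η f x₀ s hmax R Hs B j u)
   (h : IsolatedPairDropG μ P St Ready) : IsolatedPairDropG μ P' St Ready :=
 fun η f x₀ s hmax R Hs B hE j u hS hR hP' => h η f x₀ s hmax R Hs B hE j u hS hR (hPP _ _ _ _ _ _ _ _ _ _ hP')

/-- `denseLevelCensusG_mono` (W-07 c12 FieldSplit node for crux TiltedLandingLaw421; token-identical to the registered line fieldsplit_v1 d6eb6582). -/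
theorem denseLevelCensusG_mono {μ cE cE' : ℝ} (hc : cE ≤ cE') {P P' St Ready : StatePred}
   (hPP : ∀ η f x₀ s hmax R Hs B j u, P η f x₀ s hmax R Hs B j u → P' η f x₀ s hmax R Hs B j u)
   (h : DenseLevelCensusG μ cE P St Ready) : DenseLevelCensusG μ cE' P' St Ready := by
 intro η f x₀ s hmax R Hs B hE
 obtain ⟨E, lam, hlam0, hsum, hoff, hon⟩ := h η f x₀ s hmax R Hs B hE
 refine ⟨E, lam, hlam0, by linarith, ?_, hon⟩
 intro j u hj hS hR
 obtain ⟨v, hSv, hRv, hle, hPv⟩ := hoff j u hj hS hR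
 exact ⟨v, hSv, hRv, hle, hPP _ _ _ _ _ _ _ _ _ _ hPv⟩

/-- `denseLevelCensusG_of_cover` (W-07 c12 FieldSplit node for crux TiltedLandingLaw421; token-identical to the registered line fieldsplit_v1 d6eb6582). -/
theorem denseLevelCensusG_of_cover {μ cE : ℝ} (hcE : 0 ≤ cE) {P St Ready : StatePred}
   (hP : ∀ η f x₀ s hmax R Hs B j u, EngineHyps5 2 η f x₀ s hmax R Hs B → St η f x₀ s hmax R Hs B j u →
     ¬ Ready η f x₀ s hmax R Hs B j u → P η f x₀ s hmax R Hs B j u) :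
   DenseLevelCensusG μ cE P St Ready := by
 intro η f x₀ s hmax R Hs B hE
 refine ⟨∅, fun _ => 0, fun _ => le_rfl, ?_, ?_, ?_⟩
 · simp only [Finset.card_empty, Nat.cast_zero, Finset.sum_empty, zero_div, add_zero]
   positivity
 · intro j u _ hS hR
   exact ⟨u, hS, hR, le_rfl, hP _ _ _ _ _ _ _ _ _ _ hE hS hR⟩
 · intro j u hj
   simp at hj

/-- `isolatedPairDropG_bot` (W-07 c12 FieldSplit node for crux TiltedLandingLaw421; token-identical to the registered line fieldsplit_v1 d6eb6582). -/
theorem isolatedPairDropG_bot (μ : ℝ) (St Ready : StatePred) :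
   IsolatedPairDropG μ (fun _ _ _ _ _ _ _ _ _ _ => False) St Ready :=
 fun _ _ _ _ _ _ _ _ _ _ _ _ _ hP => hP.elim

/-- `IsolatedPairDrop` (W-07 c12 FieldSplit node for crux TiltedLandingLaw421; token-identical to the registered line fieldsplit_v1 d6eb6582). -/
def IsolatedPairDrop (P : StatePred) : Prop := IsolatedPairDropG (1 / 4) P StCol' (CumReady WindowReady)

/-- `DenseLevelCensusStop` (W-07 c12 FieldSplit node for crux TiltedLandingLaw421; token-identical to the registered line fieldsplit_v1 d6eb6582). -/
def DenseLevelCensusStop (P : StatePred) : Prop := DenseLevelCensusG (1 / 4) 1 P StCol' (CumReady WindowReady)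

/-- `surplusLiftSigStop_of_fieldSplitG` (W-07 c12 FieldSplit node for crux TiltedLandingLaw421; token-identical to the registered line fieldsplit_v1 d6eb6582). -/
theorem surplusLiftSigStop_of_fieldSplitG {μ cE : ℝ} {P : StatePred}
   (hα : IsolatedPairDropG μ P StCol' (CumReady WindowReady)) (hβ : DenseLevelCensusG μ cE P StCol' (CumReady WindowReady)) :
   SurplusLiftSigStop μ cE :=
 liftV'_of_fieldSplitG hα hβ

/-- `surplusLiftSigStop_of_fieldSplit` (W-07 c12 FieldSplit node for crux TiltedLandingLaw421; token-identical to the registered line fieldsplit_v1 d6eb6582). -/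
theorem surplusLiftSigStop_of_fieldSplit {P : StatePred} (hα : IsolatedPairDrop P) (hβ : DenseLevelCensusStop P) :
   SurplusLiftSigStop (1 / 4) 1 :=
 surplusLiftSigStop_of_fieldSplitG hα hβ

/-- `descentSigS'_of_fieldSplit` (W-07 c12 FieldSplit node for crux TiltedLandingLaw421; token-identical to the registered line fieldsplit_v1 d6eb6582). -/
theorem descentSigS'_of_fieldSplit {P : StatePred} (hα : IsolatedPairDrop P) (hβ : DenseLevelCensusStop P) : DescentSigS' :=
 descentSigS'_of_stop le_rfl (surplusLiftSigStop_of_fieldSplit hα hβ)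

/-- `descentSigS'_of_fieldSplitG` (W-07 c12 FieldSplit node for crux TiltedLandingLaw421; token-identical to the registered line fieldsplit_v1 d6eb6582). -/
theorem descentSigS'_of_fieldSplitG {μ : ℝ} (hμ : 1 / 4 ≤ μ) {P : StatePred}
   (hα : IsolatedPairDropG μ P StCol' (CumReady WindowReady)) (hβ : DenseLevelCensusG μ 1 P StCol' (CumReady WindowReady)) : DescentSigS' :=
 descentSigS'_of_stop hμ (surplusLiftSigStop_of_fieldSplitG hα hβ)

/-- `descentSigS_of_fieldSplit0` (W-07 c12 FieldSplit node for crux TiltedLandingLaw421; token-identical to the registered line fieldsplit_v1 d6eb6582). -/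
theorem descentSigS_of_fieldSplit0 {μ : ℝ} (hμ : 1 / 4 ≤ μ) {P : StatePred}
   (hα : IsolatedPairDropG μ P StCol' (CumReady WindowReady)) (hβ : DenseLevelCensusG μ 0 P StCol' (CumReady WindowReady)) : DescentSigS :=
 descentSigS_of_stop0 hμ (surplusLiftSigStop_of_fieldSplitG hα hβ)

/-- `fracLinP_of_fieldSplit` (W-07 c12 FieldSplit node for crux TiltedLandingLaw421; token-identical to the registered line fieldsplit_v1 d6eb6582). -/
theorem fracLinP_of_fieldSplit {P : StatePred} (hα : IsolatedPairDrop P) (hβ : DenseLevelCensusStop P) : FracLinP :=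
 fracLinP_of_stop (surplusLiftSigStop_of_fieldSplit hα hβ)

/-- `IsLowest` (W-07 c12 FieldSplit node for crux TiltedLandingLaw421; token-identical to the registered line fieldsplit_v1 d6eb6582). -/
def IsLowest (St : StatePred) : StatePred := fun η f x₀ s hmax R Hs B j v =>
 St η f x₀ s hmax R Hs B j v ∧ ∀ w : ℂ, St η f x₀ s hmax R Hs B j w → v.im ≤ w.im

/-- `HasLowestSig` (W-07 c12 FieldSplit node for crux TiltedLandingLaw421; token-identical to the registered line fieldsplit_v1 d6eb6582). -/
def HasLowestSig (St : StatePred) : Prop :=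
 ∀ (η : ℝ) (f : ℂ → ℂ) (x₀ s hmax R Hs : ℝ) (B : ℕ), EngineHyps5 2 η f x₀ s hmax R Hs B →
   ∀ (j : ℕ) (u : ℂ), St η f x₀ s hmax R Hs B j u → ∃ v : ℂ, IsLowest St η f x₀ s hmax R Hs B j v

/-- `DenseLevelCensusLow` (W-07 c12 FieldSplit node for crux TiltedLandingLaw421; token-identical to the registered line fieldsplit_v1 d6eb6582). -/
def DenseLevelCensusLow (μ cE : ℝ) (P St Ready : StatePred) : Prop :=
 ∀ (η : ℝ) (f : ℂ → ℂ) (x₀ s hmax R Hs : ℝ) (B : ℕ), EngineHyps5 2 η f x₀ s hmax R Hs B →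
   ∃ (E : Finset ℕ) (lam : ℕ → ℝ), (∀ j : ℕ, 0 ≤ lam j) ∧
     (E.card : ℝ) + (∑ e ∈ E, lam e) / (μ * s) ≤ (Hs / s) ^ 2 + B + cE ∧
     (∀ (j : ℕ) (v : ℂ), j ∉ E → IsLowest St η f x₀ s hmax R Hs B j v → ¬ Ready η f x₀ s hmax R Hs B j v →
       P η f x₀ s hmax R Hs B j v) ∧
     (∀ (j : ℕ) (u : ℂ), j ∈ E → St η f x₀ s hmax R Hs B j u → ¬ Ready η f x₀ s hmax R Hs B j u →
       ∃ u' : ℂ, St η f x₀ s hmax R Hs B (j + 1) u' ∧ |u'.im| ≤ |u.im| + lam j)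

/-- `DenseLevelCensusStopLow` (W-07 c12 FieldSplit node for crux TiltedLandingLaw421; token-identical to the registered line fieldsplit_v1 d6eb6582). -/
def DenseLevelCensusStopLow (P : StatePred) : Prop := DenseLevelCensusLow (1 / 4) 1 P StCol' (CumReady WindowReady)

/-- `denseLevelCensusStop_of_low` (W-07 c12 FieldSplit node for crux TiltedLandingLaw421; token-identical to the registered line fieldsplit_v1 d6eb6582). -/
theorem denseLevelCensusStop_of_low {μ cE : ℝ} {P : StatePred} (hL : HasLowestSig StCol')
   (h : DenseLevelCensusLow μ cE P StCol' (CumReady WindowReady)) : DenseLevelCensusG μ cE P StCol' (CumReady WindowReady) := by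
 intro η f x₀ s hmax R Hs B hE
 obtain ⟨E, lam, hlam0, hsum, hoff, hon⟩ := h η f x₀ s hmax R Hs B hE
 refine ⟨E, lam, hlam0, hsum, ?_, hon⟩
 intro j u hj hS hR
 obtain ⟨v, hSv, hmin⟩ := hL η f x₀ s hmax R Hs B hE j u hS
 have hRv : ¬ CumReady WindowReady η f x₀ s hmax R Hs B j v := hR
 refine ⟨v, hSv, hRv, ?_, hoff j v hj ⟨hSv, hmin⟩ hRv⟩
 rw [abs_of_pos hSv.2.2.1, abs_of_pos hS.2.2.1]
 exact hmin u hS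

/-- `descentSigS'_of_fieldSplitLow` (W-07 c12 FieldSplit node for crux TiltedLandingLaw421; token-identical to the registered line fieldsplit_v1 d6eb6582). -/
theorem descentSigS'_of_fieldSplitLow {P : StatePred} (hL : HasLowestSig StCol') (hα : IsolatedPairDrop P) (hβ : DenseLevelCensusStopLow P) :
   DescentSigS' :=
 descentSigS'_of_fieldSplit hα (denseLevelCensusStop_of_low hL hβ)

/-- `isolatedPairDrop_bot` (W-07 c12 FieldSplit node for crux TiltedLandingLaw421; token-identical to the registered line fieldsplit_v1 d6eb6582). -/
theorem isolatedPairDrop_bot : IsolatedPairDrop (fun _ _ _ _ _ _ _ _ _ _ => False) := isolatedPairDropG_bot _ _ _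

/-- `denseLevelCensusStop_top` (W-07 c12 FieldSplit node for crux TiltedLandingLaw421; token-identical to the registered line fieldsplit_v1 d6eb6582). -/
theorem denseLevelCensusStop_top : DenseLevelCensusStop (fun _ _ _ _ _ _ _ _ _ _ => True) :=
 denseLevelCensusG_of_cover zero_le_one (fun _ _ _ _ _ _ _ _ _ _ _ _ _ => trivial)

/-- `isolatedPairDrop_anti` (W-07 c12 FieldSplit node for crux TiltedLandingLaw421; token-identical to the registered line fieldsplit_v1 d6eb6582). -/
theorem isolatedPairDrop_anti {P P' : StatePred} (hPP : ∀ η f x₀ s hmax R Hs B j u, P' η f x₀ s hmax R Hs B j u → P η f x₀ s hmax R Hs B j u)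
   (h : IsolatedPairDrop P) : IsolatedPairDrop P' :=
 isolatedPairDropG_anti hPP h

/-- `denseLevelCensusStop_mono` (W-07 c12 FieldSplit node for crux TiltedLandingLaw421; token-identical to the registered line fieldsplit_v1 d6eb6582). -/
theorem denseLevelCensusStop_mono {P P' : StatePred} (hPP : ∀ η f x₀ s hmax R Hs B j u, P η f x₀ s hmax R Hs B j u → P' η f x₀ s hmax R Hs B j u)
   (h : DenseLevelCensusStop P) : DenseLevelCensusStop P' :=
 denseLevelCensusG_mono le_rfl hPP h

/-- `cExt` (W-07 c12 FieldSplit node for crux TiltedLandingLaw421; token-identical to the registered line fieldsplit_v1 d6eb6582). -/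
noncomputable def cExt (f : ℂ → ℂ) (j : ℕ) (u : ℂ) : ℂ :=
 iteratedDeriv (j + 2) f u / (2 * iteratedDeriv (j + 1) f u) + I / (2 * (u.im : ℂ))

/-- `pairNewtonRoots` (W-07 c12 FieldSplit node for crux TiltedLandingLaw421; token-identical to the registered line fieldsplit_v1 d6eb6582). -/
noncomputable def pairNewtonRoots (c : ℂ) (ε : ℝ) : ℂ × ℂ :=
 let d : ℂ := (1 - c ^ 2 * (ε : ℂ) ^ 2) ^ ((1 : ℂ) / 2)
 ((-1 + d) / c, (-1 - d) / c)

/-- `pairNewtonRoot` (W-07 c12 FieldSplit node for crux TiltedLandingLaw421; token-identical to the registered line fieldsplit_v1 d6eb6582). -/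
noncomputable def pairNewtonRoot (c : ℂ) (ε : ℝ) : ℂ := by
 classical
 exact if ‖(pairNewtonRoots c ε).1 - (ε : ℂ) * I‖ ≤ ‖(pairNewtonRoots c ε).2 - (ε : ℂ) * I‖
   then (pairNewtonRoots c ε).1 else (pairNewtonRoots c ε).2

/-- `pairNewtonRootHi` (W-07 c12 FieldSplit node for crux TiltedLandingLaw421; token-identical to the registered line fieldsplit_v1 d6eb6582). -/
noncomputable def pairNewtonRootHi (c : ℂ) (ε : ℝ) : ℂ := by
 classical
 exact if (pairNewtonRoots c ε).2.im ≤ (pairNewtonRoots c ε).1.im then (pairNewtonRoots c ε).1 else (pairNewtonRoots c ε).2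

/-- `dP` (W-07 c12 FieldSplit node for crux TiltedLandingLaw421; token-identical to the registered line fieldsplit_v1 d6eb6582). -/
noncomputable def dP (f : ℂ → ℂ) (j : ℕ) (u : ℂ) : ℝ := u.im - (pairNewtonRoot (cExt f j u) u.im).im
/-- `dPHi` (W-07 c12 FieldSplit node for crux TiltedLandingLaw421; token-identical to the registered line fieldsplit_v1 d6eb6582). -/
noncomputable def dPHi (f : ℂ → ℂ) (j : ℕ) (u : ℂ) : ℝ := u.im - (pairNewtonRootHi (cExt f j u) u.im).im

/-- `dX` (W-07 c12 FieldSplit node for crux TiltedLandingLaw421; token-identical to the registered line fieldsplit_v1 d6eb6582). -/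
noncomputable def dX (f : ℂ → ℂ) (j : ℕ) (u : ℂ) : ℝ := (pairNewtonRoot (cExt f j u) u.im).re

/-- `dMin` (W-07 c12 FieldSplit node for crux TiltedLandingLaw421; token-identical to the registered line fieldsplit_v1 d6eb6582). -/
noncomputable def dMin (f : ℂ → ℂ) (j : ℕ) (u : ℂ) : ℝ :=
 sInf {d : ℝ | ∃ r : ℂ, iteratedDeriv j f r = 0 ∧ r ≠ u ∧ r ≠ (starRingEnd ℂ) u ∧ d = ‖u - r‖}

/-- `iota` (W-07 c12 FieldSplit node for crux TiltedLandingLaw421; token-identical to the registered line fieldsplit_v1 d6eb6582). -/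
noncomputable def iota (f : ℂ → ℂ) (j : ℕ) (u : ℂ) : ℝ := dMin f j u * ‖cExt f j u‖

/-- `PSealC1` (W-07 c12 FieldSplit node for crux TiltedLandingLaw421; token-identical to the registered line fieldsplit_v1 d6eb6582). -/
def PSealC1 : StatePred := fun _η f _x₀ s _hmax _R _Hs _B j u =>
 (1 / 50 : ℝ) * s < (pairNewtonRoot (cExt f j u) u.im).im ∧
   ((3 ≤ iota f j u ∧ (7 / 25 : ℝ) * s ≤ dP f j u) ∨ (2 ≤ iota f j u ∧ (3 / 10 : ℝ) * s ≤ dP f j u))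

/-- `PSealC2` (W-07 c12 FieldSplit node for crux TiltedLandingLaw421; token-identical to the registered line fieldsplit_v1 d6eb6582). -/
def PSealC2 : StatePred := fun _η f _x₀ s _hmax _R _Hs _B j u =>
 (1 / 3 : ℝ) * s ≤ dPHi f j u ∧ (1 / 50 : ℝ) * s ≤ (pairNewtonRootHi (cExt f j u) u.im).im ∧ 2 ≤ iota f j u

/-- `PSealC3` (W-07 c12 FieldSplit node for crux TiltedLandingLaw421; token-identical to the registered line fieldsplit_v1 d6eb6582). -/
def PSealC3 : StatePred := fun _η f _x₀ s _hmax _R _Hs _B j u =>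
 2 ≤ iota f j u ∧ (3 / 10 : ℝ) * s ≤ dP f j u ∧ dP f j u ≤ u.im - (1 / 20 : ℝ) * s ∧ |dX f j u| ≤ (1 / 5 : ℝ) * s

/-- `PSealC6` (W-07 c12 FieldSplit node for crux TiltedLandingLaw421; token-identical to the registered line fieldsplit_v1 d6eb6582). -/
def PSealC6 : StatePred := fun _η f _x₀ s _hmax _R _Hs _B j u =>
 2 ≤ iota f j u ∧ (1 / 50 : ℝ) * s ≤ (pairNewtonRoot (cExt f j u) u.im).im ∧
   (7 / 25 : ℝ) * s + (1 / 10 : ℝ) * s / (‖cExt f j u‖ * s) ≤ dP f j u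

/-- `PSealC4` (W-07 c12 FieldSplit node for crux TiltedLandingLaw421; token-identical to the registered line fieldsplit_v1 d6eb6582). -/
def PSealC4 : StatePred := fun _η f _x₀ s _hmax _R _Hs _B j u =>
 2 ≤ iota f j u ∧ (1 / 20 : ℝ) * s ≤ (pairNewtonRoot (cExt f j u) u.im).im ∧ |dX f j u| ≤ (1 / 5 : ℝ) * s ∧
   (7 / 25 : ℝ) * s + (7 / 50 : ℝ) * s / iota f j u ^ 2 ≤ dP f j u

/-- `LemmaCountC1` (W-07 c12 FieldSplit node for crux TiltedLandingLaw421; token-identical to the registered line fieldsplit_v1 d6eb6582). -/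
def LemmaCountC1 : Prop :=
 ∀ (g : ℂ → ℂ) (Hs x₀ r : ℝ), InClass g Hs → g ≠ 0 → 0 ≤ r → nonRealCount (deriv g) x₀ r ≤ nonRealCount g x₀ (r + Hs)

/-- `LemmaCountC6` (W-07 c12 FieldSplit node for crux TiltedLandingLaw421; token-identical to the registered line fieldsplit_v1 d6eb6582). -/
def LemmaCountC6 : Prop :=
 ∀ (η : ℝ) (f : ℂ → ℂ) (x₀ s hmax R Hs : ℝ) (B : ℕ), EngineHyps5 2 η f x₀ s hmax R Hs B →
   ∀ (j : ℕ) (r : ℝ), s ≤ r → r + s ≤ R / 2 →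
     nonRealCount (iteratedDeriv (j + 1) f) x₀ r ≤ nonRealCount (iteratedDeriv j f) x₀ (r + s / 4)

/-- `LemmaSlowLevelC3` (W-07 c12 FieldSplit node for crux TiltedLandingLaw421; token-identical to the registered line fieldsplit_v1 d6eb6582). -/
def LemmaSlowLevelC3 : Prop :=
 ∀ (η : ℝ) (f : ℂ → ℂ) (x₀ s hmax R Hs : ℝ) (B : ℕ), EngineHyps5 2 η f x₀ s hmax R Hs B →
   ∀ (j : ℕ) (r : ℝ), s ≤ r →
     (∀ i ≤ j, ∀ v : ℂ, StCol' η f x₀ s hmax R Hs B i v → ¬ WindowReady η f x₀ s hmax R Hs B i v) →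
     (∃ u : ℂ, StCol' η f x₀ s hmax R Hs B j u ∧ (∀ v : ℂ, StCol' η f x₀ s hmax R Hs B j v → u.im ≤ v.im) ∧
       ¬ PSealC3 η f x₀ s hmax R Hs B j u) →
     (∑ᶠ z ∈ {z : ℂ | iteratedDeriv (j + 1) f z = 0 ∧ ‖z - x₀‖ ≤ r}, ((analyticOrderAt (iteratedDeriv (j + 1) f) z).toNat : ℝ)) + 1 ≤
       ∑ᶠ z ∈ {z : ℂ | iteratedDeriv j f z = 0 ∧ ‖z - x₀‖ ≤ r + s / 4}, ((analyticOrderAt (iteratedDeriv j f) z).toNat : ℝ)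

/-- `LemmaSlowStepFieldC2` (W-07 c12 FieldSplit node for crux TiltedLandingLaw421; token-identical to the registered line fieldsplit_v1 d6eb6582). -/
def LemmaSlowStepFieldC2 : Prop :=
 ∀ (h : ℂ → ℂ) (u u' : ℂ), DifferentiableAt ℂ h u' → h u' ≠ 0 → u' ≠ u →
   deriv (fun z => (z - u) * h z) u' = 0 → ‖deriv h u' / h u'‖ = 1 / ‖u' - u‖

/-- `LemmaColumnBudgetC4` (W-07 c12 FieldSplit node for crux TiltedLandingLaw421; token-identical to the registered line fieldsplit_v1 d6eb6582). -/
def LemmaColumnBudgetC4 : Prop :=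
 ∀ (η : ℝ) (f : ℂ → ℂ) (x₀ s hmax R Hs : ℝ) (B : ℕ), EngineHyps5 2 η f x₀ s hmax R Hs B → ColumnBudgetMult (B + 1) (deriv f) x₀ s (R / 2)

end RhW07.C12.FieldSplit
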